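import Summits.HubbardSuperconductivity.HubbardSuperconductivity.Theorems.KLProgrammeKLRegimeScaleZeroWeightedSizesCore
import Summits.HubbardSuperconductivity.HubbardSuperconductivity.Theorems.KLProgrammeKLRegimeScaleZeroLatticeSumNumeral

/-!
# Route `KLProgramme`, crux K3 — engine-flow child (stmt-HubbardSuperconductivity-20437), stub (C) at `n = 0`, located gap «(2e)-FAR-SITES» (pen (R196)),
# piece (F-e): THE FAR RING SUM over the torus — `Σ_{x₁ : ‖z_c‖_∞ > Rc} |z_c|₂^k·(1+‖z_c‖_∞)^{−2m} ≤ 9·2^k·(1+Rc)^{−(2m−k−4)}`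

Cell gate-hubbard-kl, seat p1 g21.  The far-site rows of #22a (k3c5-p1 FAR-SITES-NOTE-g14 §4 (F-e)) sum the Euclidean moment weight `√(z₀²+z₁²)^k` of the
centred representative `z_c = valMinAbs(x₁ − x₀)` against the squared spatial decay `(1+‖z_c‖_∞)^{−2m}` of (F-c)+(F-d) over the sites OUTSIDE the certified
disk `‖z_c‖_∞ ≤ Rc`.  With `√(z₀²+z₁²) ≤ 2‖z‖_∞` (crudely `√2 ≤ 2`), `(1+‖z‖)^{k−2m} = (1+‖z‖)^{−4}·(1+‖z‖)^{−(2m−k−4)} ≤ (1+‖z‖)^{−4}(1+Rc)^{−(2m−k−4)}` on the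
far ring and `Σ_{x₁}(1+‖z_c‖)^{−4} ≤ S₄ ≤ 9` (bricks 4d/4f(i)):

* `euclid_weight_le_two_mul_norm` — `√(z₀²+z₁²) ≤ 2‖z‖_∞` on `ℤ²`;
* **`sum_torusSite_farRing_le`** — for `k + 4 ≤ 2m`:
  `Σ_{x₁} [Rc < ‖z_c‖_∞]·√(z_c,0² + z_c,1²)^k·((1+‖z_c‖_∞)^m)⁻¹² ≤ 9·2^k·((1+Rc)^{2m−k−4})⁻¹` — β-, M-, L-free, decaying in the disk radius.

Proofs only; no definitions; nothing here asserts (C), any stub of 20437, K3 or superconductivity.  References: BGM 2006 §2.4 (2.80) [cite: BenfattoGiulianiMastropietro2006].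
-/

noncomputable section

namespace Summit.HubbardSuperconductivity.HubbardSuperconductivity.Theorems.KLRegimeSplit

set_option linter.dupNamespace false -- summit = problem name (single-conjunct summit), D-0017

open Literature.MathematicalPhysics.QuantumLattice Literature.Probability.LatticeModels
open Finset Real

variable {L : ℕ} [NeZero L]

omit [NeZero L] in
/-- `√(z₀² + z₁²) ≤ 2‖z‖_∞` for `z ∈ ℤ²`. -/
theorem euclid_weight_le_two_mul_norm (z : Site 2) :
    Real.sqrt ((((z 0 : ℤ) : ℝ)) ^ 2 + (((z 1 : ℤ) : ℝ)) ^ 2) ≤ 2 * ‖z‖ := by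
  have h0 : |((z 0 : ℤ) : ℝ)| ≤ ‖z‖ := by rw [← Int.norm_eq_abs]; exact norm_le_pi_norm z 0
  have h1 : |((z 1 : ℤ) : ℝ)| ≤ ‖z‖ := by rw [← Int.norm_eq_abs]; exact norm_le_pi_norm z 1
  have hz : 0 ≤ ‖z‖ := norm_nonneg _
  refine Real.sqrt_le_iff.2 ⟨by positivity, ?_⟩
  have h0' : (((z 0 : ℤ) : ℝ)) ^ 2 ≤ ‖z‖ ^ 2 := by rw [← sq_abs]; exact pow_le_pow_left₀ (abs_nonneg _) h0 2
  have h1' : (((z 1 : ℤ) : ℝ)) ^ 2 ≤ ‖z‖ ^ 2 := by rw [← sq_abs]; exact pow_le_pow_left₀ (abs_nonneg _) h1 2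
  nlinarith

/-- **(F-e) THE FAR RING SUM**: for `k + 4 ≤ 2m` and any radius `Rc`,
`Σ_{x₁} [Rc < ‖z_c(x₁−x₀)‖_∞]·√(z_c,0²+z_c,1²)^k·(((1+‖z_c‖_∞)^m)⁻¹)² ≤ 9·2^k·((1+Rc)^{2m−k−4})⁻¹`. -/
theorem sum_torusSite_farRing_le (x₀ : TorusSite 2 L) {k m : ℕ} (hkm : k + 4 ≤ 2 * m) (Rc : ℕ) :
    ∑ x₁ : TorusSite 2 L, (if (Rc : ℝ) < ‖(fun j => ((x₁ - x₀) j).valMinAbs : Site 2)‖ then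
        Real.sqrt (((((fun j => ((x₁ - x₀) j).valMinAbs : Site 2) 0 : ℤ) : ℝ)) ^ 2 + ((((fun j => ((x₁ - x₀) j).valMinAbs : Site 2) 1 : ℤ) : ℝ)) ^ 2) ^ k *
          (((1 + ‖(fun j => ((x₁ - x₀) j).valMinAbs : Site 2)‖) ^ m)⁻¹) ^ 2 else 0) ≤
      9 * 2 ^ k * ((1 + (Rc : ℝ)) ^ (2 * m - k - 4))⁻¹ := by
  set zc : TorusSite 2 L → Site 2 := fun x₁ => fun j => ((x₁ - x₀) j).valMinAbs with hzc
  have hS := sum_torusSite_inv_pow_centredRep_le_tsum (L := L) x₀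
  have hS9 := tsum_inv_one_add_norm_pow_le_nine (m := 4) le_rfl
  have hR1 : (1 : ℝ) ≤ 1 + Rc := by have : (0 : ℝ) ≤ Rc := Nat.cast_nonneg _; linarith
  -- termwise bound on the far ring
  have hterm : ∀ x₁ : TorusSite 2 L, (if (Rc : ℝ) < ‖zc x₁‖ then
      Real.sqrt ((((zc x₁ 0 : ℤ) : ℝ)) ^ 2 + (((zc x₁ 1 : ℤ) : ℝ)) ^ 2) ^ k * (((1 + ‖zc x₁‖) ^ m)⁻¹) ^ 2 else 0) ≤
      2 ^ k * ((1 + (Rc : ℝ)) ^ (2 * m - k - 4))⁻¹ * ((1 + ‖zc x₁‖) ^ 4)⁻¹ := by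
    intro x₁
    have hw0 : 0 ≤ ‖zc x₁‖ := norm_nonneg _
    split_ifs with hfar
    · have hsq := euclid_weight_le_two_mul_norm (zc x₁)
      have h1 : Real.sqrt ((((zc x₁ 0 : ℤ) : ℝ)) ^ 2 + (((zc x₁ 1 : ℤ) : ℝ)) ^ 2) ^ k ≤ (2 * (1 + ‖zc x₁‖)) ^ k :=
        pow_le_pow_left₀ (Real.sqrt_nonneg _) (hsq.trans (by linarith)) k
      have hb : 1 + (Rc : ℝ) ≤ 1 + ‖zc x₁‖ := by linarith
      have hb1 : (1 : ℝ) ≤ 1 + ‖zc x₁‖ := by linarith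
      -- `(2(1+‖z‖))^k · (1+‖z‖)^{-2m} = 2^k (1+‖z‖)^{-4} (1+‖z‖)^{-(2m-k-4)}`
      obtain ⟨r, hr⟩ : ∃ r, 2 * m = k + 4 + r := ⟨2 * m - (k + 4), by omega⟩
      have hr' : 2 * m - k - 4 = r := by omega
      rw [hr']
      have hpow : (((1 + ‖zc x₁‖) ^ m)⁻¹) ^ 2 = ((1 + ‖zc x₁‖) ^ k)⁻¹ * ((1 + ‖zc x₁‖) ^ 4)⁻¹ * ((1 + ‖zc x₁‖) ^ r)⁻¹ := by
        rw [← inv_pow, ← pow_mul, ← mul_inv, ← mul_inv, ← pow_add, ← pow_add, show m * 2 = k + 4 + r by omega, inv_pow]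
      rw [hpow]
      have hRr : ((1 + ‖zc x₁‖) ^ r)⁻¹ ≤ ((1 + (Rc : ℝ)) ^ r)⁻¹ :=
        inv_anti₀ (by positivity) (pow_le_pow_left₀ (by positivity) hb r)
      calc Real.sqrt ((((zc x₁ 0 : ℤ) : ℝ)) ^ 2 + (((zc x₁ 1 : ℤ) : ℝ)) ^ 2) ^ k *
            (((1 + ‖zc x₁‖) ^ k)⁻¹ * ((1 + ‖zc x₁‖) ^ 4)⁻¹ * ((1 + ‖zc x₁‖) ^ r)⁻¹)
          ≤ (2 * (1 + ‖zc x₁‖)) ^ k * (((1 + ‖zc x₁‖) ^ k)⁻¹ * ((1 + ‖zc x₁‖) ^ 4)⁻¹ * ((1 + (Rc : ℝ)) ^ r)⁻¹) := by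
            refine mul_le_mul h1 (mul_le_mul_of_nonneg_left hRr (by positivity)) (by positivity) (by positivity)
        _ = 2 ^ k * ((1 + (Rc : ℝ)) ^ r)⁻¹ * ((1 + ‖zc x₁‖) ^ 4)⁻¹ := by
            have hk0 : (1 + ‖zc x₁‖) ^ k ≠ 0 := by positivity
            rw [mul_pow]; field_simp
    · positivity
  calc ∑ x₁ : TorusSite 2 L, (if (Rc : ℝ) < ‖zc x₁‖ then
          Real.sqrt ((((zc x₁ 0 : ℤ) : ℝ)) ^ 2 + (((zc x₁ 1 : ℤ) : ℝ)) ^ 2) ^ k * (((1 + ‖zc x₁‖) ^ m)⁻¹) ^ 2 else 0)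
      ≤ ∑ x₁ : TorusSite 2 L, 2 ^ k * ((1 + (Rc : ℝ)) ^ (2 * m - k - 4))⁻¹ * ((1 + ‖zc x₁‖) ^ 4)⁻¹ := Finset.sum_le_sum fun x₁ _ => hterm x₁
    _ = 2 ^ k * ((1 + (Rc : ℝ)) ^ (2 * m - k - 4))⁻¹ * ∑ x₁ : TorusSite 2 L, ((1 + ‖zc x₁‖) ^ 4)⁻¹ := by rw [Finset.mul_sum]
    _ ≤ 2 ^ k * ((1 + (Rc : ℝ)) ^ (2 * m - k - 4))⁻¹ * 9 :=
        mul_le_mul_of_nonneg_left (hS.trans hS9) (by positivity)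
    _ = 9 * 2 ^ k * ((1 + (Rc : ℝ)) ^ (2 * m - k - 4))⁻¹ := by ring

end Summit.HubbardSuperconductivity.HubbardSuperconductivity.Theorems.KLRegimeSplit

end
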